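import Summits.ABC.IUTFork.LDHSplitBadPrimeExplicitL
import HarnessLib

/-!
# The fork at [IUTchIII] Corollary 3.12, L-DH level: the EXACT generating sum `Σ (n+1)²β^{n+1} = β(1+β)/(1−β)³` and the sharp
# explicit `l`-threshold `β(1+β) ≤ ℓ⋇·(1−β)³`

Proof-only companion (D-0012; 0 definitions, no `Prop` fact) of `LDHSplitBadPrimeExplicitL.lean` (p431276), abc-iut-w5-d018 (gen 4),
recording the sharpening noted by the second reader abc-iut-w5-d023 (STATUS 08:05Z). TAKES NO SIDE on [IUTchIII] Cor. 3.12.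

`(n+1)² = 2·C(n+2,2) − C(n+1,1)` and Mathlib's `Σ_n C(n+k,k)·βⁿ = 1/(1−β)^{k+1}` (`hasSum_choose_mul_geometric_of_norm_lt_one`) give the
closed form; so abc-iut-c312-3's averaged coefficient satisfies `c_p ≤ (1/ℓ⋇)·β(1+β)/(1−β)³` for bad mass `≤ β`, whence:

* `SplitBadPrime.hasSum_sq_mul_pow` / `tsum_sq_mul_pow_eq` — `Σ' n, (n+1)²·β^{n+1} = β(1+β)/(1−β)³` (`0 ≤ β < 1`);
* **`ThetaVolumeInput.cor312Of_of_badMass_le_sharp`** — `0 ≤ β < 1`, `β(1+β) ≤ ℓ⋇·(1−β)³`, bad mass `≤ β` at every support prime ⇒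
  `Cor312NonarchOf ∧ Cor312Of` (at `β = 1/2`: `ℓ⋇ ≥ 6`, i.e. `l ≥ 13` — versus `ℓ⋇ ≥ 16` from p431276's `2 ≤ ℓ⋇(1−β)³`; the uniform
  threshold `1/2` of p430071 covers every `l`).

Typed objects ((Ind1) = all capsule-index permutations, R2); no side taken; typed ≠ proved. [cite: DupuyHilado2025, §3.6, §4.7, §4.12]
[cite: Mochizuki2012, IUTchIII Cor. 3.12 p. 173–174] [claim: Mochizuki2012, status: disputed]
-/

noncomputable section

open Finset NumberField IsDedekindDomain Literature.IUT.LogVolume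

namespace Summit.ABC.IUTFork

namespace SplitBadPrime

/-- `Σ_n (n+1)²·β^{n+1} = β(1+β)/(1−β)³` for `0 ≤ β < 1` (`(n+1)² = 2·C(n+2,2) − C(n+1,1)`). [folklore] -/
theorem hasSum_sq_mul_pow {β : ℝ} (h0 : 0 ≤ β) (h1 : β < 1) :
    HasSum (fun n : ℕ => (((n : ℝ) + 1) ^ 2 * β ^ (n + 1))) (β * (1 + β) / (1 - β) ^ 3) := by
  have hr : ‖β‖ < 1 := by rwa [Real.norm_eq_abs, abs_of_nonneg h0]
  have h2 : HasSum (fun n : ℕ => (((n + 2).choose 2 : ℕ) : ℝ) * β ^ n) (1 / (1 - β) ^ 3) :=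
    hasSum_choose_mul_geometric_of_norm_lt_one 2 hr
  have h1' : HasSum (fun n : ℕ => (((n + 1).choose 1 : ℕ) : ℝ) * β ^ n) (1 / (1 - β) ^ 2) :=
    hasSum_choose_mul_geometric_of_norm_lt_one 1 hr
  have h := ((h2.mul_left 2).sub h1').mul_left β
  have hβ1 : (1 - β) ≠ 0 := by linarith
  have hfun : (fun n : ℕ => (((n : ℝ) + 1) ^ 2 * β ^ (n + 1))) =
      (fun n : ℕ => β * (2 * ((((n + 2).choose 2 : ℕ) : ℝ) * β ^ n) - (((n + 1).choose 1 : ℕ) : ℝ) * β ^ n)) := by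
    funext n
    have hc2 : (((n + 2).choose 2 : ℕ) : ℝ) = ((n : ℝ) + 2) * ((n : ℝ) + 1) / 2 := by
      rw [Nat.cast_choose_two]; push_cast; ring
    have hc1 : (((n + 1).choose 1 : ℕ) : ℝ) = (n : ℝ) + 1 := by
      rw [Nat.choose_one_right]; push_cast; ring
    rw [hc2, hc1]
    ring
  have hval : β * (1 + β) / (1 - β) ^ 3 = β * (2 * (1 / (1 - β) ^ 3) - 1 / (1 - β) ^ 2) := by
    field_simp
    ring
  rw [hfun, hval]
  exact h

/-- `Σ' n, (n+1)²·β^{n+1} = β(1+β)/(1−β)³` for `0 ≤ β < 1`. [folklore] -/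
theorem tsum_sq_mul_pow_eq {β : ℝ} (h0 : 0 ≤ β) (h1 : β < 1) :
    ∑' n : ℕ, (((n : ℝ) + 1) ^ 2 * β ^ (n + 1)) = β * (1 + β) / (1 - β) ^ 3 :=
  (hasSum_sq_mul_pow h0 h1).tsum_eq

end SplitBadPrime

section Sharp

variable {F₀ : Type} [Field F₀] [NumberField F₀] {K : Type} [Field K] [NumberField K] [Algebra F₀ K]

/-- **Sharp explicit `l`-threshold `β(1+β) ≤ ℓ⋇·(1−β)³`.** If `0 ≤ β < 1`, `β(1+β) ≤ ℓ⋇·(1−β)³`, and the bad places of the genuine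
Θ-volume input `I` over each support prime carry at most the fraction `β` of `[F₀:ℚ]`, then `Cor312NonarchOf I ∧ Cor312Of I`
(`Σ'(n+1)²β^{n+1} = β(1+β)/(1−β)³ ≤ ℓ⋇` into `cor312Of_of_badMass_le_of_tsum_le`). Typed objects; no side taken on print's Cor. 3.12.
[claim: Mochizuki2012, status: disputed] [cite: DupuyHilado2025, §3.6, §4.7, §4.12] -/
theorem ThetaVolumeInput.cor312Of_of_badMass_le_sharp (I : ThetaVolumeInput F₀ K) {β : ℝ} (h0 : 0 ≤ β) (h1 : β < 1)
    (hL : β * (1 + β) ≤ (I.lstar : ℝ) * (1 - β) ^ 3)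
    (h : ∀ p ∈ I.supportPrimes,
      ∑ v : placesOver F₀ p, (I.X.S : Set (HeightOneSpectrum (𝓞 F₀))).indicator (weight F₀) v.1 ≤ β) :
    I.Cor312NonarchOf ∧ I.Cor312Of := by
  refine ThetaVolumeInput.cor312Of_of_badMass_le_of_tsum_le I h0 h1 ?_ h
  have hpos : (0 : ℝ) < (1 - β) ^ 3 := pow_pos (by linarith) 3
  rw [SplitBadPrime.tsum_sq_mul_pow_eq h0 h1, div_le_iff₀ hpos]
  exact hL

end Sharp

end Summit.ABC.IUTFork

end
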